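import Summits.QuantumFields.YangMills.Theorems.UnitScaleTiltProp7PinnedBiharmonicAgmonWindow
import Summits.QuantumFields.YangMills.Theorems.UnitScaleTiltProp7TorusAgmonWeight
import Summits.QuantumFields.YangMills.Theorems.UnitScaleTiltProp7TorusExpWeightSum
import HarnessLib

/-!
# Route `UnitScaleTilt`, crux K1 «MinimiserStabilityRegPr» (stmt-QuantumFields-19200), route-R E′ path (α′), residue (hK), assembly (A), row (Lλ):
# THE ℓ¹-LAPLACIAN OF A PINNED-BIHARMONIC INTERPOLANT IS AT MOST THAT OF ANY EXTENSION OF THE SAME DATUM, PLUS A SCREENED ℓ² TERM —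
# in particular `Σ_z|Δλ_y(z)| ≤ C_λ·ℓ` for the Lagrange functions (take the extension to be a scale-ℓ bump), and the near-datum term of (hK)

Cell `ym3-torus`, width seat `ym3-torus-px22` (gen 2), on ★routeR-w3 g5's «px22: (A3) FAR-FIELD LOCATE» 19:28:35Z ∕ «(Lλ) too … same PASS» 19:47:38Z;
LOCATE 19200 evidence `LOCATE-A3-FARFIELD-px22g2.md` §4.  `--supports stmt-QuantumFields-19200`, count-neutral.  THEOREMS ONLY (0 `def`, 0 `sorry`).
YM₃ on T³ is a ladder rung (R3), not the Clay problem; nothing here claims the stub, the crux, d = 4 or the gap.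

THE POINT.  In the (A3) assembly `E[V] = E[(1−χ₀)V] + (χ₀V − u) + E[u]` the near datum `(χ₀V)|_C` is carried by an explicit scale-ℓ-smooth extension `u`,
and `interp(u|_C) = u − E[u]`; likewise a Lagrange function is `λ_y = β_y − E[β_y]` for any bump `β_y` with `β_y|_C = δ_y|_C`.  In both cases the
ℓ¹ mass of the Laplacian of the INTERPOLANT is bounded by that of the extension plus `√(Σω⁻²)·‖ωΔ(φ − φ_H)‖`, and the last factor is `≤ 3‖ωΔφ‖` by the
interpolation-error instance of (D2′) (✓ `weighted_laplace_le_window` fed by ✓ `el_of_biharmonic_off`).  With the (W1) weight at base `y` and (W2)'s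
torus sum this is `Σ|Δφ_H| ≤ Σ|Δφ| + (2(1 + π√d·ℓ∕(4κ)))^{d∕2}·3·e^{κ(1+R∕ℓ)}·√Σ(Δφ)²` whenever `Δφ` is supported in `{tdist(·,y) ≤ R}`.

WHAT IS PROVED (ns `…Theorems.Prop7LagrangeLaplaceL1`; torus `T^{(j)}`, lattice factor `c`, centre set `C`, real site fields).
* §1 ★★ `sum_abs_laplace_interp_le` — abstract weight `ω` (rows `a ≤ 1∕2`, `b`), pinned Poincaré row in root form (`A`), (D2′)'s numeric window:
  `Σ_z|Δφ_H(z)| ≤ Σ_z|Δφ(z)| + √(Σ_z ω(z)⁻²)·3·√Σ_z(ω(z)Δφ(z))²` for every `φ` and every pinned interpolant `φ_H` of `φ|_C` biharmonic off `C`.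
* §2 ★★★ `sum_abs_laplace_interp_le_scale` — the same with the (W1) weight ✓ `exists_admissible_weight (y) (ℓ) (κ)` and the (W2) count
  ✓ `sum_exp_neg_mul_tdist_le`: `Σ|Δφ_H| ≤ Σ|Δφ| + √((2(1 + (4κ∕(π√dℓ))⁻¹))^d)·(3·e^{κ(1+R∕ℓ)}·√Σ(Δφ)²)` if `Δφ = 0` outside `{tdist(·,y) ≤ R}`;
  (Lλ) is the instance `φ := β_y` (a bump equal to `δ_y` on `C`), `φ_H := λ_y`.
HONEST SCOPE.  The pinned Poincaré row (D1-glob) and the two window rows stay DISPLAYED (✓p658748 `sum_sq_le_laplace_sq_of_vanish_on_range` inhabits the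
former at `j = 0`, `C = range (embIter k)`, `A = √(C_G∕c⁴)·(L^k)²`; the latter read `κ·2|c|√d·A^{1∕2}∕ℓ ≤ 1∕100`, `κ·4c²d·A∕ℓ² ≤ 1∕50`, ℓ-free); no bump is
constructed here (✓p660942 `exists_scale_cutoff`), no Green-function letter enters.  Flat letters only.

References: T. Bałaban, CMP 96 (1984) 223–250 [Balaban1984PropagatorsII] ((1.9) p.226, (2.61) p.234); CMP 99 (1985) 75–102 [Balaban1985RegularSpaces] ((1.14) p.78,
(1.36) p.82); CMP 102 (1985) 277–309 [Balaban1985Variational] (Prop. 7 p.299).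
-/

set_option autoImplicit false

noncomputable section

open scoped BigOperators

namespace Summit.QuantumFields.YangMills.Theorems.Prop7LagrangeLaplaceL1

open Literature.MathematicalPhysics.QuantumFieldTheory.Balaban1983to89
open Finset LatticeFieldCalculus
open Summit.QuantumFields.YangMills.Theorems.Prop7CentreHarmonicInterpKernel (laplace_sub')
open Summit.QuantumFields.YangMills.Theorems.Prop7PinnedBiharmonicAgmonDecay (el_of_biharmonic_off)
open Summit.QuantumFields.YangMills.Theorems.Prop7PinnedBiharmonicAgmonWindow (weighted_laplace_le_window)
open Summit.QuantumFields.YangMills.Theorems.Prop7TorusAgmonWeight (exists_admissible_weight)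
open Summit.QuantumFields.YangMills.Theorems.Prop7TorusExpWeightSum (sum_exp_neg_mul_tdist_le sum_abs_le_sqrt_mul_sqrt)

variable {P : Params} {j : ℕ}

/-! ## §1 ★★ Abstract weight -/

/-- ★★ **ℓ¹-LAPLACIAN OF THE INTERPOLANT ≤ ℓ¹-LAPLACIAN OF ANY EXTENSION + SCREENED ℓ²**: for a weight `ω` with the two (D2′) rows, the pinned
Poincaré row in root form with constant `A`, the numeric window of ✓ `weighted_laplace_le_window`, and `φ_H` a pinned interpolant of `φ|_C` that is
biharmonic off `C`:  `Σ_z|Δφ_H(z)| ≤ Σ_z|Δφ(z)| + √(Σ_z ω(z)⁻²)·3·√Σ_z(ω(z)Δφ(z))²`.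
[cite: Balaban1984PropagatorsII, (1.9) p.226; Balaban1985Variational, Prop. 7 p.299] -/
theorem sum_abs_laplace_interp_le (c : ℝ) (C : Set (Site P j)) (ω φ φH : SiteField P j ℝ)
    {a b A : ℝ} (ha0 : 0 ≤ a) (hb0 : 0 ≤ b) (hA : 0 ≤ A)
    (hω₀ : ∀ x, 0 < ω x)
    (hω₁ : ∀ x μ, |ω (x.shift μ) - ω x| ≤ a * ω x ∧ |ω (x.unshift μ) - ω x| ≤ a * ω x)
    (hω₂ : ∀ x μ, |ω (x.shift μ) + ω (x.unshift μ) - 2 * ω x| ≤ b * ω x)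
    (hP : ∀ v : SiteField P j ℝ, (∀ y ∈ C, v y = 0) →
      Real.sqrt (∑ x, v x ^ 2) ≤ A * Real.sqrt (∑ x, laplace c v x ^ 2))
    (hH : ∀ x ∈ C, φH x = φ x) (hEL : ∀ x ∉ C, laplace c (laplace c φH) x = 0)
    (ha : a ≤ 1 / 2) (hwin₁ : a * |c| * Real.sqrt P.d * Real.sqrt A ≤ 1 / 100) (hwin₂ : b * c ^ 2 * P.d * A ≤ 1 / 50) :
    ∑ z, |laplace c φH z|
      ≤ ∑ z, |laplace c φ z| + Real.sqrt (∑ z, (ω z)⁻¹ ^ 2) * (3 * Real.sqrt (∑ z, (ω z * laplace c φ z) ^ 2)) := by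
  -- the interpolation error is pinned and satisfies the type-1 EL identity
  have he : ∀ y ∈ C, (fun x => φ x - φH x) y = 0 := fun y hy => by simp [hH y hy]
  have hEL' := el_of_biharmonic_off c C φ φH hEL
  have hwl := (weighted_laplace_le_window c C ω (fun x => φ x - φH x) (laplace c φ) (fun _ => (0 : ℝ)) (fun _ => (0 : ℝ))
    ha0 hb0 hA hω₀ hω₁ hω₂ hP he hEL' ha hwin₁ hwin₂).1
  simp only [mul_zero, ne_eq, OfNat.ofNat_ne_zero, not_false_eq_true, zero_pow, Finset.sum_const_zero,
    Real.sqrt_zero, add_zero] at hwl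
  -- ℓ² → ℓ¹ on the error
  have hcs := sum_abs_le_sqrt_mul_sqrt (Finset.univ : Finset (Site P j)) ω (laplace c (fun x => φ x - φH x)) (fun x _ => hω₀ x)
  have h1 : ∑ z, |laplace c (fun x => φ x - φH x) z|
      ≤ Real.sqrt (∑ z, (ω z)⁻¹ ^ 2) * (3 * Real.sqrt (∑ z, (ω z * laplace c φ z) ^ 2)) :=
    hcs.trans (mul_le_mul_of_nonneg_left hwl (Real.sqrt_nonneg _))
  -- triangle inequality `Δφ_H = Δφ − Δ(φ − φ_H)`
  have h2 : ∀ z, |laplace c φH z| ≤ |laplace c φ z| + |laplace c (fun x => φ x - φH x) z| := by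
    intro z
    rw [laplace_sub']
    have e : laplace c φH z = laplace c φ z - (laplace c φ z - laplace c φH z) := by ring
    rw [e]
    exact abs_sub _ _
  calc ∑ z, |laplace c φH z| ≤ ∑ z, (|laplace c φ z| + |laplace c (fun x => φ x - φH x) z|) := Finset.sum_le_sum fun z _ => h2 z
    _ = ∑ z, |laplace c φ z| + ∑ z, |laplace c (fun x => φ x - φH x) z| := Finset.sum_add_distrib
    _ ≤ _ := add_le_add le_rfl h1

/-! ## §2 ★★★ The scale-ℓ instance with the (W1) weight and the (W2) count -/

/-- `√(Σ M²·t_z) = M·√(Σ t_z)` bookkeeping: if `0 ≤ s z ≤ M² t z` termwise then `√Σ s ≤ M √Σ t` (`M ≥ 0`). [folklore] -/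
theorem sqrt_sum_le_mul_sqrt_sum {ι : Type*} (S : Finset ι) (s t : ι → ℝ) {M : ℝ} (hM : 0 ≤ M)
    (h : ∀ z ∈ S, s z ≤ M ^ 2 * t z) :
    Real.sqrt (∑ z ∈ S, s z) ≤ M * Real.sqrt (∑ z ∈ S, t z) := by
  calc Real.sqrt (∑ z ∈ S, s z) ≤ Real.sqrt (∑ z ∈ S, M ^ 2 * t z) := Real.sqrt_le_sqrt (Finset.sum_le_sum h)
    _ = Real.sqrt (M ^ 2 * ∑ z ∈ S, t z) := by rw [Finset.mul_sum]
    _ = M * Real.sqrt (∑ z ∈ S, t z) := by rw [Real.sqrt_mul (sq_nonneg M), Real.sqrt_sq hM]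

/-- ★★★ **THE SCALE-ℓ ℓ¹ BOUND FOR INTERPOLANTS (row (Lλ) and the near-datum term of (hK)).**  Base point `y`, scale `ℓ ≥ 1`, rate `0 < κ ≤ 1` with `2κ∕ℓ ≤ 1∕2`;
the pinned Poincaré row in root form (constant `A ≥ 0`) and the two ℓ-free window rows `(2κ∕ℓ)|c|√d·√A ≤ 1∕100`, `(4κ∕ℓ²)c²d·A ≤ 1∕50` DISPLAYED; `φ_H` a pinned
interpolant of `φ|_C` biharmonic off `C`; `Δφ` supported in `{tdist(·,y) ≤ R}`.  Then
`Σ_z|Δφ_H(z)| ≤ Σ_z|Δφ(z)| + √((2(1 + (4κ∕(π√d·ℓ))⁻¹))^d)·(3·e^{κ(1+R∕ℓ)}·√Σ_z(Δφ(z))²)`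
— with `φ := β_y` (✓ `exists_scale_cutoff` at base `y`, equal to `δ_y` on `C`) and `φ_H := λ_y` this is `Σ_z|Δλ_y(z)| ≤ C_λ·ℓ` (`Σ|Δβ| ≍ ℓ`, `√Σ(Δβ)² ≍ ℓ^{−1∕2}`,
`√(…)^d ≍ ℓ^{3∕2}` in d = 3). [cite: Balaban1984PropagatorsII, (1.9) p.226, (2.61) p.234; Balaban1985RegularSpaces, (1.36) p.82] -/
theorem sum_abs_laplace_interp_le_scale (c : ℝ) (C : Set (Site P j)) (y : Site P j) {ℓ κ A R : ℝ}
    (hℓ : 1 ≤ ℓ) (hκ0 : 0 < κ) (hκ1 : κ ≤ 1) (ha : 2 * κ / ℓ ≤ 1 / 2) (hA : 0 ≤ A)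
    (hP : ∀ v : SiteField P j ℝ, (∀ y ∈ C, v y = 0) →
      Real.sqrt (∑ x, v x ^ 2) ≤ A * Real.sqrt (∑ x, laplace c v x ^ 2))
    (hwin₁ : 2 * κ / ℓ * |c| * Real.sqrt P.d * Real.sqrt A ≤ 1 / 100) (hwin₂ : 4 * κ / ℓ ^ 2 * c ^ 2 * P.d * A ≤ 1 / 50)
    (φ φH : SiteField P j ℝ) (hH : ∀ x ∈ C, φH x = φ x) (hEL : ∀ x ∉ C, laplace c (laplace c φH) x = 0)
    (hsupp : ∀ z, R < (Site.tdist z y : ℝ) → laplace c φ z = 0) :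
    ∑ z, |laplace c φH z|
      ≤ ∑ z, |laplace c φ z|
        + Real.sqrt ((2 * (1 + 1 / (4 * κ / (Real.pi * Real.sqrt P.d * ℓ)))) ^ P.d)
          * (3 * (Real.exp (κ * (1 + R / ℓ)) * Real.sqrt (∑ z, laplace c φ z ^ 2))) := by
  have hℓ0 : 0 < ℓ := by linarith
  have hπ := Real.pi_pos
  have hd0 : 0 < (P.d : ℝ) := by exact_mod_cast Nat.lt_of_lt_of_le Nat.zero_lt_one P.hd
  have hsd : 0 < Real.sqrt P.d := Real.sqrt_pos.mpr hd0
  obtain ⟨ω, hω₀, hω₁, hω₂, hlo, hhi⟩ := exists_admissible_weight y hℓ hκ0.le hκ1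
  have ha0 : 0 ≤ 2 * κ / ℓ := by positivity
  have hb0 : 0 ≤ 4 * κ / ℓ ^ 2 := by positivity
  have h1 := sum_abs_laplace_interp_le c C ω φ φH ha0 hb0 hA hω₀ hω₁ hω₂ hP hH hEL ha hwin₁ hwin₂
  -- the (W2) count of `Σ ω⁻²`
  set a' : ℝ := 4 * κ / (Real.pi * Real.sqrt P.d * ℓ) with ha'
  have ha'0 : 0 < a' := by rw [ha']; positivity
  have hcount : ∑ z, (ω z)⁻¹ ^ 2 ≤ (2 * (1 + 1 / a')) ^ P.d := by
    refine le_trans (Finset.sum_le_sum fun z _ => ?_) (sum_exp_neg_mul_tdist_le y ha'0)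
    -- `ω⁻² ≤ e^{−a'·tdist}`
    have hz := hlo z
    have hωz := hω₀ z
    have e1 : Real.exp (-(a' * (Site.tdist z y : ℝ))) = (Real.exp (2 * κ / (Real.pi * Real.sqrt P.d * ℓ) * (Site.tdist z y : ℝ)) ^ 2)⁻¹ := by
      rw [← Real.exp_nat_mul, ← Real.exp_neg, ha']
      congr 1
      push_cast
      ring
    rw [e1, inv_pow]
    exact inv_anti₀ (by positivity) (pow_le_pow_left₀ (Real.exp_pos _).le hz 2)
  -- the weight on the support of `Δφ`
  have hwt : Real.sqrt (∑ z, (ω z * laplace c φ z) ^ 2) ≤ Real.exp (κ * (1 + R / ℓ)) * Real.sqrt (∑ z, laplace c φ z ^ 2) := by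
    refine sqrt_sum_le_mul_sqrt_sum _ _ _ (Real.exp_pos _).le fun z _ => ?_
    by_cases hz : R < (Site.tdist z y : ℝ)
    · rw [hsupp z hz]; simp
    · push Not at hz
      have hω : ω z ≤ Real.exp (κ * (1 + R / ℓ)) := by
        refine (hhi z).trans (Real.exp_le_exp.mpr ?_)
        have : (Site.tdist z y : ℝ) / ℓ ≤ R / ℓ := div_le_div_of_nonneg_right hz hℓ0.le
        nlinarith
      rw [mul_pow]
      exact mul_le_mul_of_nonneg_right (pow_le_pow_left₀ (hω₀ z).le hω 2) (sq_nonneg _)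
  calc ∑ z, |laplace c φH z| ≤ _ := h1
    _ ≤ ∑ z, |laplace c φ z| + Real.sqrt ((2 * (1 + 1 / a')) ^ P.d) * (3 * (Real.exp (κ * (1 + R / ℓ)) * Real.sqrt (∑ z, laplace c φ z ^ 2))) := by
        refine add_le_add le_rfl (mul_le_mul (Real.sqrt_le_sqrt hcount) ?_ (by positivity) (Real.sqrt_nonneg _))
        exact mul_le_mul_of_nonneg_left hwt (by norm_num)

end Summit.QuantumFields.YangMills.Theorems.Prop7LagrangeLaplaceL1

end
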